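import Mathlib.Analysis.InnerProductSpace.PiL2
import Literature.Analysis.FluidPDE.SelfSimilar
import Literature.Analysis.FluidPDE.AxisymmetricEuler
import HarnessLib

/-!
# Liouville theorem for bounded helically symmetric steady Navier–Stokes flows on `ℝ³`

Topic `Literature/Analysis/FluidPDE`; one named fact (result in print, `def … : Prop`, D-0014) plus
its elementary surroundings, typed for the blow-up scenario census of `NavierStokesRegularity`
(cell `pub/ns-census`, row S6 "steady · helical": the only helical Liouville theorem found in print
by that cell's literature seat), as a sibling of `SteadyLiouvilleCriteria.lean` (Galdi's problem and
its printed criteria: `L^{9/2}`, annular, axisymmetric-no-swirl).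

**Source.** J. Han, Y. Wang, C. Xie, *Liouville-type theorems for steady Navier–Stokes system under
helical symmetry or Navier boundary conditions*, arXiv:2312.10382 (2023) [HanWangXie2023] (held
text; the helical part is published as Sci. China Math. 69 (2025) 737–746 [HanWangXie2025]):

* §1, display after (1.2): the helical group `𝒢_κ = {S_ρ : ρ ∈ ℝ}`, `S_ρ(x) = R_ρ x + (0, 0, κρ)`,
  `R_ρ` the rotation by the angle `ρ` about the `x₃`-axis, `κ ≠ 0` the pitch; a vector field `u` is
  *helically symmetric* iff `u(S_ρ(x)) = R_ρ u(x)` for all `ρ ∈ ℝ` — here `IsHelicallySymmetric κ U`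
  ("hence any helically symmetric flow is periodic in `x₃`-direction, with a period `2π|κ|`").
* **Theorem 1.1**: "Assume that `u` is a bounded smooth helically symmetric solution to the
  Navier–Stokes system (1.1) [`−Δu + (u·∇)u + ∇P = 0`, `∇·u = 0`] in `ℝ³`. Then `u` must be a
  constant vector of the form `(0, 0, C)`." — here the named fact `HanWangXie2023_helical_liouville`
  (NOT proved in the tree: the printed proof runs a Saint-Venant estimate for the Dirichlet integral
  over growing cylinders in the periodic slab `ℝ² × 𝕋`, Lemmas 2.3/2.7 of the source and its §3).

## Rendering choices

* Rotation convention. The source's matrix `R_ρ = ((cos ρ, sin ρ, 0), (−sin ρ, cos ρ, 0), (0,0,1))`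
  is the CLOCKWISE rotation, i.e. the tree's `rotZ (−ρ)` (`AxisymmetricEuler.rotZ` is
  counter-clockwise). Substituting `ρ ↦ −ρ`, the source's symmetry under `𝒢_κ` is exactly
  `IsHelicallySymmetric (−κ) U` below; every statement here quantifies over all pitches `κ ≠ 0`
  (or holds for each fixed `κ`), so nothing depends on the sign convention.
* Pitch. The source normalises `κ = 1/(2π)` "for simplicity" (§1); the Navier–Stokes scaling
  `U ↦ λU(λ·)`, `P ↦ λ²P(λ·)` maps pitch `κ` to `κ/λ` and preserves boundedness, smoothness and the
  steady system, so the theorem for one non-zero pitch is the theorem for all — we state all `κ ≠ 0`.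
* "smooth steady solution" is the tree's steady profile structure `IsLerayProfile ν 0 U P`
  (`SelfSimilar.lean`: `U ∈ C²`, `P ∈ C¹`, `−νΔU + (U·∇)U + ∇P = 0`, `div U = 0` pointwise) plus
  `ContDiff ℝ ∞` of `U` and `P` (the source says "smooth"; requiring it of `P` as well only weakens
  the fact), exactly as in `SteadyLiouvilleCriteria.lean`; "bounded" is `∃ M, ∀ x, ‖U x‖ ≤ M`.
* Viscosity. Printed `ν = 1`; stated for every `ν > 0`, equivalent by `U ↦ ν⁻¹U`, `P ↦ ν⁻²P`
  (boundedness and helical symmetry are invariant), as in the sibling file.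
* The conclusion "`u = (0,0,C)`" is `∃ C : ℝ, U = fun _ ↦ C • eZ` (`eZ = e₃` of `AxisymmetricEuler`).

## Deliberately statement-only

This file declares the predicate and the named fact and proves nothing; the elementary kernel facts
around them — `2π|κ|`-periodicity along the axis (one full turn of the screw is the translation by
`2πκ e₃`, `rotZ_two_pi`), "a constant helically symmetric field is axial" (half turn,
`eq_smul_eZ_of_rotZ_pi_eq`; the closing step of the source's proof), "pitch `0` is axisymmetry", and
"a helically symmetric field of non-zero pitch tending to `0` at infinity vanishes" (so the
D-SOLUTION form of the helical Liouville problem is vacuous and Theorem 1.1, bounded without decay,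
is the meaningful helical statement) — are proved where they are used, on the summit side
(`Summits/NavierStokesRegularity/NavierStokesRegularity/Theorems/ScenarioCensusSteady.lean`, rows S6/S6v).

WHAT IS NOT HERE: Theorems 1.2–1.4 of the source (slabs `ℝ² × (0,1)` with Navier / no-slip boundary
conditions; axisymmetric solutions with sublinear growth) — other domains, other vocabulary. No
statement about time-dependent (ancient) helical solutions, for which nothing is in print.
-/

noncomputable section

open MeasureTheory Filter Set
open _root_.Topology

namespace Literature.Analysis.FluidPDE

/-! ### Helical symmetry (the hypothesis class) -/

/-- **Helical symmetry** of a vector field `U : ℝ³ → ℝ³` with pitch `κ` (Han–Wang–Xie 2023, §1: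
invariance under the helical group `𝒢_κ` of screw motions `S_ρ(x) = R_ρ x + κρ e₃`, `ρ ∈ ℝ`, in the
equivariant sense `U(S_ρ x) = R_ρ U(x)`), written with the tree's counter-clockwise rotation `rotZ`
(the source's `R_ρ` is clockwise, which replaces `κ` by `−κ`; see the module docstring). For `κ = 0`
this is plain axisymmetry `IsAxisymmetric`; the helical case is `κ ≠ 0`, and then `U` is
`2π|κ|`-periodic along the axis (take `ρ = 2π`: `rotZ_two_pi`).
[cite: HanWangXie2023, §1 (definition of 𝒢_κ and of helically symmetric vector fields, after (1.2))] -/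
def IsHelicallySymmetric (κ : ℝ) (U : EuclideanSpace ℝ (Fin 3) → EuclideanSpace ℝ (Fin 3)) : Prop :=
  ∀ (ρ : ℝ) (x : EuclideanSpace ℝ (Fin 3)), U (rotZ ρ x + (κ * ρ) • eZ) = rotZ ρ (U x)

/-! ### The named fact -/

/-- **Liouville theorem for bounded helically symmetric steady flows** (Han–Wang–Xie 2023,
Theorem 1.1: "Assume that `u` is a bounded smooth helically symmetric solution to the Navier–Stokes
system `−Δu + (u·∇)u + ∇P = 0`, `∇·u = 0` in `ℝ³`. Then `u` must be a constant vector of the form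
`(0, 0, C)`."). For every viscosity `ν > 0` (printed `ν = 1`; `U ↦ ν⁻¹U`) and every pitch `κ ≠ 0`
(printed WLOG `κ = 1/(2π)`; scaling): a smooth steady solution `IsLerayProfile ν 0 U P` on `ℝ³`
with `U` bounded and helically symmetric (`IsHelicallySymmetric κ U`) is an axial constant
`U ≡ C e₃`. NO decay and NO finite Dirichlet integral is assumed (with decay to `0` at infinity
the helical class is empty, by periodicity along the axis); the constancy is the content (a
constant helically symmetric field is axial by the half turn `ρ = π`). Not proved in the tree (printed proof: reduction to
the periodic slab `ℝ² × 𝕋`, bounded gradient and periodic pressure from the authors' companion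
paper, Saint-Venant growth estimate of the Dirichlet integral over cylinders).
[cite: HanWangXie2023, Theorem 1.1] -/
def HanWangXie2023_helical_liouville : Prop :=
  ∀ ν : ℝ, 0 < ν → ∀ κ : ℝ, κ ≠ 0 →
    ∀ (U : EuclideanSpace ℝ (Fin 3) → EuclideanSpace ℝ (Fin 3)) (P : EuclideanSpace ℝ (Fin 3) → ℝ),
      IsLerayProfile ν 0 U P → ContDiff ℝ (⊤ : ℕ∞) U → ContDiff ℝ (⊤ : ℕ∞) P →
      (∃ M : ℝ, ∀ x, ‖U x‖ ≤ M) → IsHelicallySymmetric κ U →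
        ∃ C : ℝ, U = fun _ => C • eZ

end Literature.Analysis.FluidPDE

end
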